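import Mathlib
import HarnessLib
import HarnessLib.Audit
import Summits.NavierStokesRegularity.Statement
import Literature.Analysis.FluidPDE.ClassicalSolution
import Literature.Analysis.FluidPDE.LerayHopf
import Literature.Analysis.FluidPDE.VectorCalculus
import Literature.Analysis.FluidPDE.AxisymmetricEuler
import Literature.Analysis.FluidPDE.SelfSimilarLiouville
import Literature.Analysis.FluidPDE.LocalTypeI
import Literature.Analysis.FluidPDE.NSWave0

/-!
Route: SwirlSignGeometry

CLOSED (retired) 2026-08-15T13:49:08Z by operator:999:1257524 — reason: not-a-thesis: assembly does not conclude the sub-problem Statement — note: D-0027 §2.1 audit (human 2026-08-15: routes that do not decide the summit are removed): the assembly concludes `Literature.Analysis.FluidPDE.AxisymmetricSwirlRegularity`, not the sub-problem statement; a NEW conforming route may be opened from the same idea (generated `closes : … → _root_.NavierStok. The file is kept as the record of this route; refuted decls are indexed as negative knowledge (`ledger negatives`).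

# Route SwirlSignGeometry — NavierStokesRegularity, positive side, AXISYMMETRIC INTERMEDIATE THESIS
(PROBLEMS.md §3); realises idea card swirl-sign-geometry

## Target and its place under the summit
TARGET = the wall AX `Literature.Analysis.FluidPDE.AxisymmetricSwirlRegularity` (ns.S25: global
classical bounded-energy solutions from every smooth divergence-free rapidly decaying AXISYMMETRIC
datum), NOT Clay (A): an axisymmetric theorem implies neither A nor ¬A, and this route does not
pretend otherwise. Summit-side wiring is already PROVED in the tree:
`Literature.NS.certifiedBlowup_kill_edge` (stmt-NavierStokesRegularity-0729): AX → X5b → ¬X5a_axi,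
i.e. AX (with Clay-class uniqueness X5b, stmt-…-0153) REFUTES the axisymmetric blow-up thesis of
route CertifiedBlowup (stmt-…-0727) — this route is the positive adversary of that thesis and the
axisymmetric rung of every positive route.

## Thesis X ("it suffices to show") = NoBlowupAxisym
In words: for every ν > 0, every classical solution of unforced NS on ℝ³ × [0,T) that is Leray–Hopf
on [0,T), bounded on every sub-slab [0,T'] × ℝ³ (T' < T), has axisymmetric slices and a rapidly
decaying datum, extends as a classical solution past T.
Lean (elaborates, Sketch.lean rc 0; decl NoBlowupAxisym):
 ∀ ν T, 0<ν → 0<T → ∀ u p, IsClassicalNSSolutionOn (Ico 0 T) ν 0 u p → IsLerayHopfOn T ν 0 (u 0) u →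
(∀ T'<T, ∃ M, ∀ t ∈ Icc 0 T', ∀ x, ‖u t x‖ ≤ M) → (∀ t ∈ Ico 0 T, IsAxisymmetric (u t)) →
HasRapidSpatialDecay (u 0) → HasSmoothExtensionPast ν 0 u T
(The standing hypotheses are exactly `AxisymmetricTypeIHyp` of
Literature/Analysis/FluidPDE/AxisymmetricTypeIBounded.lean WITHOUT its Type I field, plus decay of
the datum, so provers reuse the PROVED local-to-global glue of the KNSS no-Type-I programme:
off-axis boundedness, boundedness at infinity, exists_bound_final_slab,
hasSmoothExtensionPast_of_bounded_holds.)

## How X is to be shown (the card's mechanism, as ranked cruxes)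
Read axisymmetric NS through the SIGN of the only vortex source ∂_z(u_θ/r)² of η = ω_θ/r (Hou–Li
variables): rings of positive η pump fluid up the axis, so a swirl MAXIMUM along the axis is a
compression point that expels its own angular momentum (self-repelling; Brown–Lopez/Benjamin vortex
breakdown as an inequality), while a swirl MINIMUM — in particular a sign change of Γ = r u_θ across
a horizontal plane, the configuration of every computed candidate (Luo–Hou 2014, Hou 2022: u_θ odd
in z) and of Chae's Euler axis locus {2∂_r u_θ = 0, ∂_z u_z > 0} — is a stretching point fed by
inflow.
 L (crux, rank 2) SignChangeAtSingularAxisPoints: at a first blow-up time T, every backward-singular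
AXIS point (T,x₀) sees both signs of the swirl Γ(u(t)) in every parabolic neighbourhood (T−ε²,T) ×
B_ε(x₀). NEW necessity claim; it contains one-signed-swirl regularity.
 B (crux, rank 3) PoloidalCirculationBound: the poloidal circulation density sup_{t<T} sup_{x,r} r⁻¹
∫_{B_r(x)} |ω_θ(t)| is finite (torque budget: its only source is the centrifugal torque 2(u_θ/r)∂_z
u_θ, bounded by |∇u|², so growth at scale r needs poloidal Type-II-ness at the same scales).
 OS (crux, rank 4) OneSignedSwirlNoBlowup: Γ₀ ≥ 0 ⇒ no blow-up (the first rung of L: Γ ≥ 0 persists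
by the maximum principle, so L leaves no admissible singular axis point).
 K (support) PoloidalCirculationCriterion: B's bound ⇒ continuation past T (Adams I₂: Morrey → BMO
for the poloidal stream vector; ‖u_θ e_θ‖_{Ḃ⁻¹_{∞,∞}} ≲ ‖Γ₀‖_∞ free; Seregin–Zhou arXiv:1802.03600
Thm 1.2 / Lei–Zhang arXiv:1011.5066 Thm 1.4; in-tree continuation).
 Glue (support) NoBlowupAxisymToWall: X → AX (local classical theory for Schwartz data, propagation
of axisymmetry by uniqueness, energy inequality; the axisymmetric twin of stmt-…-0055).
Assembly (formal, proved in Sketch.lean): B → K → (X → AX) → AX. L and OS are rungs implied by X (OS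
⇐ X proved in Sketch.lean); they carry the card's falsifiable structure and key its staffing.

Rationale: WHY THIS LINE. In the axisymmetric class NS is critical, not supercritical: Γ = r u_θ obeys a
maximum principle, singular points lie on the axis (CKN; SereginSverak2009 §3) and are Type II
(KochNadirashviliSereginSverak2009 Thms 6.1–6.2, barrier AxisymmetricTypeIExclusion). What is
missing is WHERE on the axis and in WHICH scale-invariant quantity the Type-II-ness must show. The
card imports the vortex-breakdown physics (Benjamin1962; Brown–Lopez 1990
doi:10.1017/s0022112090003676: breakdown needs negative azimuthal vorticity produced by axial swirl
gradients) as exact sign facts of the Hou–Li system (arXiv:math/0608295 Thm 1, p.2 sign remark;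
Hou–Lei doi:10.1002/cpa.20254): D_t η = νΔ₅η + ∂_z(g²), D_t g = νΔ₅g − 2(u_r/r)g, g = u_θ/r. A swirl
maximum on the axis is self-repelling (compression, outflow), a sign change of Γ across a plane is a
ratchet (stretching, inflow) — the configuration chosen in LuoHou2014 / Hou2022PotentiallySingularNS
and the Euler locus of Chae arXiv:0803.1784 Thm 1.1. Crux L turns this into a NECESSITY statement
for NS singularities; crux B names the budgeted quantity (poloidal circulation density, fed only by
centrifugal torque ≤ |∇u|²); K closes via Adams1975 + Seregin–Zhou arXiv:1802.03600 Thm 1.2 (or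
Lei–Zhang arXiv:1011.5066 Thm 1.4) + proved in-tree continuation.
RANKED CRUXES. L (2): sign change of Γ in every parabolic nbhd of a singular axis point — most
informative: refuted by any one-signed focusing scenario, proved ⇒ every blow-up is a
counter-rotating collision. B (3): a-priori bound on sup_t sup_{x,r} r⁻¹∫_{B_r(x)}|ω_θ| — the
critical estimate; with K it gives X. OS (4): Γ₀ ≥ 0 ⇒ no blow-up — first rung of L, cleanest test
of the mechanism. Support: K (criterion), NoBlowupAxisymToWall (X → AX), Assembly B → K → (X→AX) →
AX (formal; proved in planner Sketch).
KILL CRITERIA. (i) An axisymmetric (numerical or rigorous) blow-up scenario with Γ ≥ 0 near the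
singular point kills L and OS and the whole line (file as ¬OS). (ii) On Hou's class-(O) solution
(arXiv:2107.06509) a SATURATING poloidal circulation density with ‖ω‖_∞ ↑ ∞ contradicts B∧K only if
blow-up is real — but a rigorous Type-II axisymmetric blow-up (X5a_axi, stmt-0727) refutes X, B and
AX at once. (iii) K fails only if the p = 1 Morrey→BMO step or the localisation at t = T breaks —
then restate K over Ḃ⁻¹_{∞,∞} directly.
DELIBERATELY NOT DECOMPOSED. No children under B (torque-budget inequality r⁻¹∫_{B_r}|ω_θ(t)| ≤
r⁻¹∫_{B_2r}|ω_θ(t−r²)| + C·E(2r) + C(r‖b‖_{L^∞(Q_2r)}/ν)·sup_s(2r)⁻¹∫_{B_2r}|ω_θ(s)|, Lei–Zhang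
Hölder bootstrap at a sign change) until L or OS moves; no local version of B/K (B_loc near
sign-change points + local criterion via Lei–Zhang Thm 1.1) until L is proved — then B is restated
locally by a glued split. DROPPED from the card after planner computation (NOTES.md §Cone): the
even-class invariant cone (S1) — the forcing of ∂_z(u_θ/r) on {z>0} is ω_z·∂_z²(ψ_θ/r), unsigned;
η-rings closer to the symmetry plane than 0.87× their radius turn the swirl maximum into a minimum
(A and B alternate: an axisymmetric inertial wave), so no invariant region of that shape; its
regularity content survives as OS. NOT FILED: the axis Riccati (card C = Chae Thm 1.1 for Euler):
for NS the term ν(Δu_z)_z is not closed on the axis, so no axis maximum principle; heuristic only.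
TARGET CHOICE. Assembly ends in the wall AX, not in NavierStokesRegularity (role default), because
AX ↛ A; PROBLEMS.md §3 lists AX as an intermediate thesis and the proved kill edge stmt-0729 (AX →
X5b → ¬X5a_axi) is its summit-side use. An item 'AX → A' would be Clay (A) in disguise (cf. retired
card lions-threshold-bmr-or-tao).
PRIOR DECLS REUSED (support only): AxisymmetricTypeIBounded/OffAxis/Infinity/Axis.lean
(IsBoundedNearTop, exists_bound_final_slab, off-axis + infinity inputs PROVED — their core uses the
Type I rate only for u ∈ L³(slab), replace by L²H¹ interpolation),
KNSSTypeII.hasSmoothExtensionPast_of_bounded (PROVED), LocalTypeI.IsBackwardSingularPoint,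
AxisymmetricEuler.swirl/swirlVelocity/cylRadius, VectorCalculus.curl. No docs/m5/inspiration read
(plancard mode; none needed).

Novelty: Searched zbMATH 2026-08-15 ('axisymmetric Navier-Stokes swirl' 29 hits; '… vorticity criterion'; '…
angular velocity'; '… positive swirl'; 'Kubica Pokorny Zajaczkowski'; 'vortex breakdown azimuthal
vorticity negative'; 'Morrey vorticity') and read arXiv:1011.5066 pp.3–4, arXiv:1802.03600 pp.2–3,
arXiv:0803.1784 p.3, arXiv:1206.4567 pp.2–3 (lit/galaxy daemons down, OpenAlex/arXiv rate-limited;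
NOTES). Nearest prior art: sign-SENSITIVE criteria exist but are integrability conditions — KPZ
arXiv:1206.4567 Thm 1 (weighted Serrin on u_r⁺), Neustupa–Pokorný doi:10.21136/mb.2001.134015,
Grygierzec–Zajączkowski arXiv:2507.14964; the on-axis zero-of-angular-velocity locus is Chae
arXiv:0803.1784 Thm 1.1 (Euler, SUFFICIENT for blow-up given ∂_r²p ≥ 0); the sign remark is Hou–Li
arXiv:math/0608295 p.2; the criteria behind K are Seregin–Zhou arXiv:1802.03600 Thm 1.2 and
Lei–Zhang arXiv:1011.5066 Thm 1.4; Morrey-vorticity smallness is GigaMiyakawa1989; structure near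
maximal points Lei–Zhang arXiv:1008.4172; breakdown physics Benjamin1962, Brown–Lopez
doi:10.1017/s0022112090003676. DELTA: nobody states (L) a sign change of Γ as NECESSARY at an NS
singular axis point, nor (OS) one-signed-swirl regularity as a target, nor (B) the poloidal
circulation density as the torque-budgeted quantity whose boundedness is axisymmetric regularity.
Card graded new-combination (refuter audit 4-0): [Hou–Li/Chae axis sign-Riccati + ring Biot–Savart
sign] × [CKN axis localisation + critical-norm necessity].  [refs: 10.21136/mb.2001.134015, 10.1017/s0022112090003676., 1011.5066, 1802.03600, 0803.1784, 1206.4567, 2507.14964, math/0608295, 1008.4172, doi:10.21136/mb.2001.134015, doi:10.1017/s0022112090003676., GigaMiyakawa1989, Benjamin1962]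

Barriers (technique_class: axisymmetric-blowup-scenario swirl-sign-structure): technique_class: axisymmetric-blowup-scenario swirl-sign-structure
- Literature.Barriers.NavierStokesRegularity.AxisymmetricTypeIExclusion: consistent, refined, never
contradicted — it says an axisymmetric singularity is Type II (pointwise rate); L/B say WHERE (sign
change of Γ on the axis) and in WHICH scale-invariant quantity (poloidal circulation density ⇒
scaled energies via Seregin–Zhou) Type-II-ness must show; no Type I rate is assumed anywhere.
- Literature.Barriers.NavierStokesRegularity.EnergySupercriticality: applies to B (critical a-priori
bound), not evaded by size; the bet is structure outside Tao's ingredient list — the swirl maximum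
principle |Γ| ≤ ‖Γ₀‖_∞ (critical and coercive on u_θ) plus the SIGN of the η-source — the kind of
input by which UY1968, KNSS Thms 5.2–5.3, CSTY and Lei–Zhang already beat scaling in this class.
- Literature.Barriers.NavierStokesRegularity.TaoAveragedBlowup: not engaged — vorticity equation in
a symmetry class, maximum principles, pointwise signs; none survives averaging (Tao2016AveragedNS
§1.2).
- Literature.Barriers.NavierStokesRegularity.CriticalNormBlowupNecessity: consistent — B∧K is a
sup-type critical quantity giving regularity; the barrier's 'critical norms blow up at a
singularity' is ¬B there; B is claimed only for axisymmetric flows.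
- NS-inequality fakes (NavierStokesInequalitySingularSolutions.lean, Scheffer): no vorticity/swirl
transport in those constructions; L, B, OS all use it.
- Negatives index: empty at filing.

Novelty grade: new-combination — ROUTE GRADE (refuter 75e0ddac, route-review gen-1 pass 3, 2026-08-15): NEW-COMBINATION = [Hou–Li / Chae axis sign structure of the η-source ∂_z(u_θ/r)² and vortex-breakdown sign physics (arXiv:math/0608295 p.2; arXiv:0803.1784 Thm 1.1; Benjamin 1962; Brown–Lopez doi:10.1017/s0022112090003676)] × [CK (refuter refuter-rreview-route-RiemannHypothesis--75e0ddac-0, 2026-08-15T13:56:03Z; prior: arXiv:math/0608295 (Hou-Li p.2 sign remark), arXiv:0803.1784 (Chae Thm 1.1, Euler axis locus), doi:10.1017/s0022112090003676 (Brown-Lopez 1990), KochNadirashviliSereginSverak2009 (Thms 6.1-6.2), arXiv:1802.03600 (Seregin-Zhou Thm 1.2 + axisym corollary), arXiv:1011.5066 (Lei-Zhang Thm 1.4), arXiv:1206.4567 (KPZ Thm 1, sign-sensitive integrability), doi:10.21136/mb.2001.134015 (Neustupa-Pokorny), d)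

History (route lifecycle, newest last):
- 2026-08-15T13:49:08Z · CLOSED retired — not-a-thesis: assembly does not conclude the sub-problem Statement (operator:999:1257524)

sub-problem: NavierStokesRegularity · status: closed(retired) · opened planner-plancard-NavierStokesRegularity-Navie-f733e7a0-0 2026-08-15T10:52:11Z · rev 2 · ledger route-NavierStokesRegularity-SwirlSignGeometry
GENERATED by the gate from the ledger (D-0016/17). Provers cite these decls: `theorem foo : Summit.NavierStokesRegularity.NavierStokesRegularity.Theses.SwirlSignGeometry.<Decl> := …` in Summits/NavierStokesRegularity/NavierStokesRegularity/Theorems/<Name>.lean.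
-/

namespace Summit.NavierStokesRegularity.NavierStokesRegularity.Theses.SwirlSignGeometry

open scoped BigOperators Topology Manifold Classical MeasureTheory ProbabilityTheory Matrix InnerProductSpace ComplexConjugate ContinuousMap
open Filter Set Function TopologicalSpace MeasureTheory

attribute [summit_statement] _root_.NavierStokesRegularity

open Literature.NS

/-- item stmt-NavierStokesRegularity-1134 · target · rank 0 · closed · moot by None · by planner
why it might fail: A genuine axisymmetric singularity (necessarily Type II, KNSS Thm 6.2) — Hou's z-odd scenario arXiv:2107.06509 made rigorous on R^3 with Schwartz data — refutes X, B and AX at once; no critical a-priori control beyond the swirl bound ||Gamma||_inf is known (LeiZhang2017 §1).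
sources: KochNadirashviliSereginSverak2009, Hou2022PotentiallySingularNS, SereginSverak2009, LeiZhang2017
[target] X = NoBlowupAxisym: every classical solution of unforced NS on ℝ³×[0,T) that is Leray–Hopf
on [0,T), bounded on sub-slabs [0,T']×ℝ³, with axisymmetric slices and rapidly decaying datum
extends classically past T. Standing hypotheses = AxisymmetricTypeIHyp
(AxisymmetricTypeIBounded.lean) minus its Type I field, plus HasRapidSpatialDecay (u 0). Follows
from B + K (Assembly); implies the rungs L and OS. Dedup note: this is the axisymmetric restriction
of NoBlowup (stmt-NavierStokesRegularity-0054) with the KNSS Thm 6.2 setting's sub-slab boundedness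
added. -/
@[route_item "route-NavierStokesRegularity-SwirlSignGeometry"]
def NoBlowupAxisym : Prop :=
  ∀ (ν T : ℝ), 0 < ν → 0 < T → ∀ (u : ℝ → EuclideanSpace ℝ (Fin 3) → EuclideanSpace ℝ (Fin 3)) (p : ℝ → EuclideanSpace ℝ (Fin 3) → ℝ), Literature.Analysis.FluidPDE.IsClassicalNSSolutionOn (Set.Ico 0 T) ν 0 u p → Literature.Analysis.FluidPDE.IsLerayHopfOn T ν 0 (u 0) u → (∀ T' < T, ∃ M : ℝ, ∀ t ∈ Set.Icc 0 T', ∀ x, ‖u t x‖ ≤ M) → (∀ t ∈ Set.Ico 0 T, Literature.Analysis.FluidPDE.IsAxisymmetric (u t)) → Literature.Analysis.FluidPDE.HasRapidSpatialDecay (u 0) → Literature.Analysis.FluidPDE.HasSmoothExtensionPast ν 0 u T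

/-- item stmt-NavierStokesRegularity-1135 · crux · rank 2 · closed · moot by None · by planner
why it might fail: Strictly contains one-signed-swirl regularity (open; print has only |Gamma|<=C|ln r|^-2 or small ||Gamma_0||_inf: LeiZhang2017 Cor 1.3/Thm 1.4, Wei2016). A one-signed focusing core / travelling swirl front (Gamma>0, inflow-stretching on its low-swirl flank) = singular axis point w/o sign change.
sources: LeiZhang2017, Wei2016, KochNadirashviliSereginSverak2009, Hou2022PotentiallySingularNS, LuoHou2014, arXiv:0803.1784
[crux] L (localisation by sign): at the first blow-up time T of an axisymmetric finite-energy
classical solution, every backward-singular AXIS point (T,x₀) (IsBackwardSingularPoint, cylRadius x₀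
= 0) has, for every ε>0, a time t ∈ (T−ε²,T) and points y,y' ∈ B_ε(x₀) with Γ(u(t))(y) > 0 >
Γ(u(t))(y') (Γ = swirl = x₀u₁−x₁u₀ = r u_θ). Mechanism: the η-source ∂_z(u_θ/r)² makes an axial
swirl MAXIMUM a compression point that expels its angular momentum (self-repelling; vortex-breakdown
sign, Brown–Lopez 1990) and a swirl MINIMUM a stretching/inflow point; a one-signed minimum refills
(D_t g = (∂_z u_z) g > 0 raises it, diffusion too), only a sign change is pinned — the z-odd
collision of Luo–Hou arXiv:1310.0497 / Hou arXiv:2107.06509 and Chae's Euler axis locus {2∂_r u_θ =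
0, ∂_z u_z > 0} (arXiv:0803.1784 Thm 1.1). Restates the card's (S2) 'nondegenerate zeros of g' in a
form that does not silently assume one-signed regularity (that consequence is the separate rung OS).
Tools foreseen: quantified consequence A (delayed compression at near-maximal swirl), Lei–Zhang
arXiv:1011.5066 Thm 1.1 (Hölder Γ at the axis under ‖b‖_E < ∞), Lei–Zhang arXiv:1505.02628 (Γ small
near the axis ⇒ regular), -/
@[route_item "route-NavierStokesRegularity-SwirlSignGeometry"]
def SignChangeAtSingularAxisPoints : Prop :=
  ∀ (ν T : ℝ), 0 < ν → 0 < T → ∀ (u : ℝ → EuclideanSpace ℝ (Fin 3) → EuclideanSpace ℝ (Fin 3)) (p : ℝ → EuclideanSpace ℝ (Fin 3) → ℝ), Literature.Analysis.FluidPDE.IsClassicalNSSolutionOn (Set.Ico 0 T) ν 0 u p → Literature.Analysis.FluidPDE.IsLerayHopfOn T ν 0 (u 0) u → (∀ T' < T, ∃ M : ℝ, ∀ t ∈ Set.Icc 0 T', ∀ x, ‖u t x‖ ≤ M) → (∀ t ∈ Set.Ico 0 T, Literature.Analysis.FluidPDE.IsAxisymmetric (u t)) → Literature.Analysis.FluidPDE.HasRapidSpatialDecay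 (u 0) → ∀ x₀ : EuclideanSpace ℝ (Fin 3), Literature.Analysis.FluidPDE.cylRadius x₀ = 0 → Literature.Analysis.FluidPDE.IsBackwardSingularPoint u (T, x₀) → ∀ ε : ℝ, 0 < ε → ∃ t ∈ Set.Ioo (T - ε ^ 2) T, ∃ y y' : EuclideanSpace ℝ (Fin 3), dist y x₀ < ε ∧ dist y' x₀ < ε ∧ 0 < Literature.Analysis.FluidPDE.swirl (u t) y ∧ Literature.Analysis.FluidPDE.swirl (u t) y' < 0

/-- item stmt-NavierStokesRegularity-1136 · crux · rank 3 · closed · moot by None · by planner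
why it might fail: Critical Morrey bound <=> axisym. regularity modulo K (arXiv:1802.03600 Thm 1.2): barrier EnergySupercriticality; best a-priori bound in print |omega_theta|<=B1 r^-5 (arXiv:0811.1609 Thm 1), 3 powers off; torque 2(u_theta/r)d_z u_theta unsigned, budget |grad u|^2 supercritical; Hou's scenario => oo.
sources: arXiv:1802.03600, arXiv:0811.1609, Hou2022PotentiallySingularNS, GigaMiyakawa1989, arXiv:1011.5066, arXiv:1309.6625
[crux] B (torque budget): under the standing hypotheses there is M with ∫_{B_r(x)} |ω_θ(t)| ≤ M·r
for all t<T, x, r>0 (ω_θ = swirlVelocity (curl u) = ⟨curl u, e_θ⟩; poloidal circulation density =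
critical Morrey norm of the azimuthal vorticity, finite at t=0 for rapidly decaying data). Why this
quantity: |ω_θ| obeys ∂_t|ω_θ| + b·∇|ω_θ| − ν(Δ−r⁻²)|ω_θ| ≤ |u_r/r||ω_θ| + 2|u_θ/r||∂_z u_θ| with
|u_r/r|, |u_θ/r| ≤ |∇u|, so localising gives r⁻¹∫_{B_r}|ω_θ(t)| ≤ r⁻¹∫_{B_2r}|ω_θ(t−r²)| + C·E(2r) +
C(r‖b‖_{L^∞(Q_2r)}/ν)·sup_s (2r)⁻¹∫_{B_2r}|ω_θ(s)| + viscous, E(r) = r⁻¹∫∫_{Q_r}|∇u|² (Seregin's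
scaled dissipation): growth of poloidal circulation at scale r needs poloidal Type-II-ness at the
SAME scales; its only source is centrifugal torque, small where Γ is small (Lei–Zhang Hölder theory
at a sign change of Γ). Anchor r = ∞: Constantin's global L¹ vorticity bound. With K this gives X.
The card's (S3'), kept GLOBAL in space so that K can be the printed whole-space criterion; a local
version near sign-change points is deferred until L is proved. -/
@[route_item "route-NavierStokesRegularity-SwirlSignGeometry"]
def PoloidalCirculationBound : Prop :=
  ∀ (ν T : ℝ), 0 < ν → 0 < T → ∀ (u : ℝ → EuclideanSpace ℝ (Fin 3) → EuclideanSpace ℝ (Fin 3)) (p : ℝ → EuclideanSpace ℝ (Fin 3) → ℝ), Literature.Analysis.FluidPDE.IsClassicalNSSolutionOn (Set.Ico 0 T) ν 0 u p → Literature.Analysis.FluidPDE.IsLerayHopfOn T ν 0 (u 0) u → (∀ T' < T, ∃ M : ℝ, ∀ t ∈ Set.Icc 0 T', ∀ x, ‖u t x‖ ≤ M) → (∀ t ∈ Set.Ico 0 T, Literature.Analysis.FluidPDE.IsAxisymmetric (u t)) → Literature.Analysis.FluidPDE.HasRapidSpatialDecay (u 0) → ∃ M : ℝ, ∀ t ∈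 Set.Ico 0 T, ∀ (x : EuclideanSpace ℝ (Fin 3)) (r : ℝ), 0 < r → ∫⁻ y in Metric.ball x r, ‖Literature.Analysis.FluidPDE.swirlVelocity (Literature.Analysis.FluidPDE.curl (u t)) y‖ₑ ≤ ENNReal.ofReal (M * r)

/-- item stmt-NavierStokesRegularity-1137 · crux · rank 4 · closed · moot by None · by planner
why it might fail: Open: Gamma_0>=0 carries no smallness (Gamma dimensionless; u_theta->-u_theta is a symmetry: only absence of a sign CHANGE has content); print has |Gamma|<=C|ln r|^-2, small ||Gamma_0||_inf, small swirl (LeiZhang2017, Wei2016, arXiv:2302.00730); a co-rotating core focusing at delta(t)->0 evades all.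
sources: LeiZhang2017, Wei2016, ChenFangZhang2017, arXiv:2302.00730, KochNadirashviliSereginSverak2009, arXiv:math/0608295
[crux] OS (first rung of L): if moreover Γ₀ = swirl (u 0) ≥ 0 everywhere, the solution extends past
T. Γ ≥ 0 persists (maximum principle for ∂_tΓ + b·∇Γ = ν(Δ − (2/r)∂_r)Γ, in-tree swirl_transport;
strong maximum principle ⇒ u_θ/r > 0 on the axis for t>0), so L admits no singular axis point;
off-axis points and spatial infinity are handled by the PROVED inputs of
AxisymmetricTypeIOffAxis/Infinity.lean (Type I field used there only for u ∈ L³(slab): replace by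
L²H¹ interpolation), then exists_bound_final_slab + hasSmoothExtensionPast_of_bounded_holds. So OS =
L restricted + glue; it is also implied by X (proved in planner Sketch). Cleanest test of the whole
mechanism: co-rotating stacked vortices must relax (minimum of u_θ/r along the axis refills), never
collide. -/
@[route_item "route-NavierStokesRegularity-SwirlSignGeometry"]
def OneSignedSwirlNoBlowup : Prop :=
  ∀ (ν T : ℝ), 0 < ν → 0 < T → ∀ (u : ℝ → EuclideanSpace ℝ (Fin 3) → EuclideanSpace ℝ (Fin 3)) (p : ℝ → EuclideanSpace ℝ (Fin 3) → ℝ), Literature.Analysis.FluidPDE.IsClassicalNSSolutionOn (Set.Ico 0 T) ν 0 u p → Literature.Analysis.FluidPDE.IsLerayHopfOn T ν 0 (u 0) u → (∀ T' < T, ∃ M : ℝ, ∀ t ∈ Set.Icc 0 T', ∀ x, ‖u t x‖ ≤ M) → (∀ t ∈ Set.Ico 0 T, Literature.Analysis.FluidPDE.IsAxisymmetric (u t)) → Literature.Analysis.FluidPDE.HasRapidSpatialDecay (u 0) → (∀ x, 0 ≤ Literature.Analysis.FluidPDE.swirl (u 0) x) → Literature.Analysis.FluidPDE.HasSmoothExtensionPast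 ν 0 u T

/-- item stmt-NavierStokesRegularity-1138 · support · rank 9 · closed · moot by None · by planner
why it might fail: Only whole-space versions are in print and both are stated for suitable weak solutions with their own pressure class; matching the tree's Leray–Hopf/classical setting and the endpoint p=1 Morrey→BMO step are the risks (fallback: restate B directly in Ḃ⁻¹_{∞,∞}).
sources: arXiv:1802.03600, arXiv:1011.5066, Adams1975, RobinsonRodrigoSadowski2016
[support] K (criterion, known-level + glue): the bound of B implies HasSmoothExtensionPast. Route:
(i) poloidal part b = curl B_pol with B_pol = (−Δ)⁻¹(ω_θ e_θ), ‖B_pol(t)‖_BMO ≲ sup_{x,r}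
r⁻¹∫_{B_r(x)}|ω_θ(t)| (Adams1975 Riesz potential I₂: Morrey L^{1,1} → BMO; elementary p=1 proof in
planner NOTES: far part Lipschitz, near part mean ≲ M); (ii) swirl part: ‖u_θ e_θ‖_{Ḃ⁻¹_{∞,∞}} ≲
‖Γ‖_∞ ≤ ‖Γ₀‖_∞ (|u_θ| ≤ ‖Γ₀‖_∞/r and e^{tΔ}(1/r) ≤ c t^{-1/2}); BMO⁻¹ ⊂ Ḃ⁻¹_{∞,∞}; (iii) vendor as a
Literature fact Seregin–Zhou arXiv:1802.03600 Thm 1.2 (suitable weak on ℝ³×]0,T[ with v ∈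
L^∞(0,T;Ḃ⁻¹_{∞,∞}) ⇒ all scaled energies bounded at every z₀ ∈ ℝ³×]0,T]) + its stated corollary
(axially symmetric ⇒ no Type I blow-up in the scaled-energy sense ⇒ every point regular), or
Lei–Zhang arXiv:1011.5066 Thm 1.4 (v = ∇×B, sup_t‖B‖_BMO ≤ C_* ⇒ smooth on ℝ³×(0,T]); (iv) local
boundedness at every (T,x₀) + PROVED far-field input (AxisymmetricTypeIInfinity.lean pattern) ⇒
bounded on [0,T)×ℝ³ (exists_bound_final_slab, exists_bound_Ico_of_final_slab) ⇒
hasSmoothExtensionPast_of_bounded_holds. May take the vendored fact(s) as hypotheses if the grounder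
so rules (then restate with `(h : fact) →`). -/
@[route_item "route-NavierStokesRegularity-SwirlSignGeometry"]
def PoloidalCirculationCriterion : Prop :=
  ∀ (ν T : ℝ), 0 < ν → 0 < T → ∀ (u : ℝ → EuclideanSpace ℝ (Fin 3) → EuclideanSpace ℝ (Fin 3)) (p : ℝ → EuclideanSpace ℝ (Fin 3) → ℝ), Literature.Analysis.FluidPDE.IsClassicalNSSolutionOn (Set.Ico 0 T) ν 0 u p → Literature.Analysis.FluidPDE.IsLerayHopfOn T ν 0 (u 0) u → (∀ T' < T, ∃ M : ℝ, ∀ t ∈ Set.Icc 0 T', ∀ x, ‖u t x‖ ≤ M) → (∀ t ∈ Set.Ico 0 T, Literature.Analysis.FluidPDE.IsAxisymmetric (u t)) → Literature.Analysis.FluidPDE.HasRapidSpatialDecay (u 0) → (∃ M : ℝ, ∀ t ∈ Set.Ico 0 T, ∀ (x : EuclideanSpace ℝ (Fin 3)) (r : ℝ), 0 < r → ∫⁻ y in Metric.ball x r, ‖Literature.Analysis.FluidPDE.swirlVelocity (Literature.Analysis.FluidPDE.curl (u t)) y‖ₑ ≤ ENNReal.ofReal (M * r)) → Literature.Analysis.FluidPDE.HasSmoothExtensionPast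 ν 0 u T

/-- item stmt-NavierStokesRegularity-1139 · support · rank 9 · closed · moot by None · by planner
sources: Fefferman2000, KochNadirashviliSereginSverak2009, RobinsonRodrigoSadowski2016
[support] Glue X → AX (axisymmetric twin of stmt-NavierStokesRegularity-0055; read its
grounder/refuter notes first): for a smooth divergence-free rapidly decaying axisymmetric datum take
the local classical Leray–Hopf solution (fact Literature.NS.local_classical_existence_schwartz /
local_classical_lerayHopf as ruled for 0055), which is bounded on compact sub-slabs and stays
axisymmetric (rotation covariance IsClassicalNSSolutionOn.conj_linearIsometryEquiv +
weak_strong_uniqueness, or isAxisymmetric_of_data_holds); at its maximal time T* apply X to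
contradict maximality; glue to a global classical solution on Ici 0; bounded energy from the energy
inequality; conclude the three conjuncts of AxisymmetricSwirlRegularity. Takes the same named
local-theory facts as hypotheses if the grounder so rules. -/
@[route_item "route-NavierStokesRegularity-SwirlSignGeometry"]
def NoBlowupAxisymToWall : Prop :=
  (∀ (ν T : ℝ), 0 < ν → 0 < T → ∀ (u : ℝ → EuclideanSpace ℝ (Fin 3) → EuclideanSpace ℝ (Fin 3)) (p : ℝ → EuclideanSpace ℝ (Fin 3) → ℝ), Literature.Analysis.FluidPDE.IsClassicalNSSolutionOn (Set.Ico 0 T) ν 0 u p → Literature.Analysis.FluidPDE.IsLerayHopfOn T ν 0 (u 0) u → (∀ T' < T, ∃ M : ℝ, ∀ t ∈ Set.Icc 0 T', ∀ x, ‖u t x‖ ≤ M) → (∀ t ∈ Set.Ico 0 T, Literature.Analysis.FluidPDE.IsAxisymmetric (u t)) → Literature.Analysis.FluidPDE.HasRapidSpatialDecay (u 0) → Literature.Analysis.FluidPDE.HasSmoothExtensionPast ν 0 u T) → Literature.Analysis.FluidPDE.AxisymmetricSwirlRegularity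

/-- item stmt-NavierStokesRegularity-1140 · assembly · rank 1 · closed · moot by None · by planner
sources: Fefferman2000
[assembly] B → K → (X → AX) → Literature.Analysis.FluidPDE.AxisymmetricSwirlRegularity, i.e.
PoloidalCirculationBound → PoloidalCirculationCriterion → NoBlowupAxisymToWall → AX. Purely formal
(5 lines, proved in the planner's Sketch.lean: from hB, hK get X pointwise, feed the glue). TARGET
IS THE WALL AX (intermediate thesis, PROBLEMS.md §3), not NavierStokesRegularity: AX ↛ Clay (A);
summit-side use = proved kill edge certifiedBlowup_kill_edge (stmt-0729): AX → X5b → ¬X5a_axi. -/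
@[route_item "route-NavierStokesRegularity-SwirlSignGeometry"]
def Assembly : Prop :=
  (∀ (ν T : ℝ), 0 < ν → 0 < T → ∀ (u : ℝ → EuclideanSpace ℝ (Fin 3) → EuclideanSpace ℝ (Fin 3)) (p : ℝ → EuclideanSpace ℝ (Fin 3) → ℝ), Literature.Analysis.FluidPDE.IsClassicalNSSolutionOn (Set.Ico 0 T) ν 0 u p → Literature.Analysis.FluidPDE.IsLerayHopfOn T ν 0 (u 0) u → (∀ T' < T, ∃ M : ℝ, ∀ t ∈ Set.Icc 0 T', ∀ x, ‖u t x‖ ≤ M) → (∀ t ∈ Set.Ico 0 T, Literature.Analysis.FluidPDE.IsAxisymmetric (u t)) → Literature.Analysis.FluidPDE.HasRapidSpatialDecay (u 0) → ∃ M : ℝ, ∀ t ∈ Set.Ico 0 T, ∀ (x : EuclideanSpace ℝ (Fin 3)) (r : ℝ), 0 < r → ∫⁻ y in Metric.ball x r, ‖Literature.Analysis.FluidPDE.swirlVelocity (Literature.Analysis.FluidPDE.curl (u t)) y‖ₑ ≤ ENNReal.ofReal (M * r)) → (∀ (ν T : ℝ), 0 < ν → 0 < T → ∀ (u : ℝ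 → EuclideanSpace ℝ (Fin 3) → EuclideanSpace ℝ (Fin 3)) (p : ℝ → EuclideanSpace ℝ (Fin 3) → ℝ), Literature.Analysis.FluidPDE.IsClassicalNSSolutionOn (Set.Ico 0 T) ν 0 u p → Literature.Analysis.FluidPDE.IsLerayHopfOn T ν 0 (u 0) u → (∀ T' < T, ∃ M : ℝ, ∀ t ∈ Set.Icc 0 T', ∀ x, ‖u t x‖ ≤ M) → (∀ t ∈ Set.Ico 0 T, Literature.Analysis.FluidPDE.IsAxisymmetric (u t)) → Literature.Analysis.FluidPDE.HasRapidSpatialDecay (u 0) → (∃ M : ℝ, ∀ t ∈ Set.Ico 0 T, ∀ (x : EuclideanSpace ℝ (Fin 3)) (r : ℝ), 0 < r → ∫⁻ y in Metric.ball x r, ‖Literature.Analysis.FluidPDE.swirlVelocity (Literature.Analysis.FluidPDE.curl (u t)) y‖ₑ ≤ ENNReal.ofReal (M * r)) → Literature.Analysis.FluidPDE.HasSmoothExtensionPast ν 0 u T) → ((∀ (ν T : ℝ), 0 < ν → 0 < T → ∀ (u : ℝ → EuclideanSpace ℝ (Fin 3) → EuclideanSpace ℝ (Fin 3)) (p : ℝ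 → EuclideanSpace ℝ (Fin 3) → ℝ), Literature.Analysis.FluidPDE.IsClassicalNSSolutionOn (Set.Ico 0 T) ν 0 u p → Literature.Analysis.FluidPDE.IsLerayHopfOn T ν 0 (u 0) u → (∀ T' < T, ∃ M : ℝ, ∀ t ∈ Set.Icc 0 T', ∀ x, ‖u t x‖ ≤ M) → (∀ t ∈ Set.Ico 0 T, Literature.Analysis.FluidPDE.IsAxisymmetric (u t)) → Literature.Analysis.FluidPDE.HasRapidSpatialDecay (u 0) → Literature.Analysis.FluidPDE.HasSmoothExtensionPast ν 0 u T) → Literature.Analysis.FluidPDE.AxisymmetricSwirlRegularity) → Literature.Analysis.FluidPDE.AxisymmetricSwirlRegularity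

end Summit.NavierStokesRegularity.NavierStokesRegularity.Theses.SwirlSignGeometry
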